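import Literature.Geometry.Manifold.SubmersionLift
import HarnessLib

/-!
# Lifting a vector FIELD of the base through a submersion, optionally tangent to the level sets of an
# auxiliary function along a closed set

General differential topology; theorems only (no definition, no named fact). Sequel of
`Literature/Geometry/Manifold/SubmersionLift` (Bröcker–Jänich 1982, proof of (8.12): the basic fields of the base
lift through a map with onto differential, locally by linear algebra in a chart and globally by a partition of
unity). There the lifted vector is a CONSTANT `c : F`; the geometric monodromy of a degeneration (Arnold–Gusein-Zade–
Varchenko II §1.1, §2.1: lift of the ROTATION field `c ↦ ic` of the base disc, tangent to the spheres of a Milnor ball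
in a shell so that the monodromy diffeomorphism is supported in the ball) needs two refinements, proved here by the
same method:

* `exists_local_lift_eq_of_surjective_mfderiv` — local lifts with a prescribed SMOOTHLY VARYING value:
  `mfderiv g x (X x) = c x` near `x₀`, for `c : N → F` smooth and `mfderiv g x₀` onto;
* `exists_contMDiff_lift_eq_of_surjective_mfderiv` — global version on a `σ`-compact Hausdorff manifold: for `g` with
  onto differential everywhere and `c : N → F` smooth, a `C^∞` field `X` with `mfderiv g x (X x) = c x` for all `x`;
  in particular (`exists_contMDiff_lift_vectorField`) a lift of a smooth vector field `W` of the base,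
  `mfderiv g x (X x) = W (g x)`;
* `exists_contMDiff_lift_vectorField_tangent` — **lift of `W` which is moreover tangent to the level sets of a smooth
  `ρ : N → F₂` along a closed set `K`** (`mfderiv ρ x (X x) = 0` for `x ∈ K`), provided the pair `(g, ρ)` has onto
  differential at the points of `K` (near `K` lift `(W ∘ g, 0)` through `(g, ρ)`, away from `K` lift `W ∘ g` through
  `g`; the conditions are affine in `X x`, glue by `exists_contMDiffSection_forall_mem_convex_of_local`).

## References

* [BrockerJanichIDT1982] Th. Bröcker, K. Jänich, Introduction to Differential Topology, CUP 1982, (8.12) and its proof.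
* [ArnoldGuseinzadeVarchenko2012] V. I. Arnold, S. M. Gusein-Zade, A. N. Varchenko, Singularities of Differentiable Maps,
  Vol. 2, Part I §1.1 (held text p0013: the monodromy as the flow of a lifted field, identity off the ball), §2.1.
-/

open scoped Manifold ContDiff Topology
open Set Function Filter Bundle

noncomputable section

namespace Literature.Geometry.Manifold

universe u v

section Lift

variable {EN : Type u} [NormedAddCommGroup EN] [NormedSpace ℝ EN] [FiniteDimensional ℝ EN]
  {H : Type v} [TopologicalSpace H] {I : ModelWithCorners ℝ EN H} [I.Boundaryless]
  {N : Type*} [TopologicalSpace N] [ChartedSpace H N] [IsManifold I ∞ N]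
  {F : Type*} [NormedAddCommGroup F] [NormedSpace ℝ F] [FiniteDimensional ℝ F]
  {g : N → F}

-- the tangent spaces are the model vector spaces by definition, which the derivative lemmas for
-- maps between vector spaces must see through
set_option backward.isDefEq.respectTransparency false in
/-- **Local lifts with prescribed smoothly varying values**: if `g : N → F` is `C^∞` with `mfderiv g x₀` onto and
`c : N → F` is `C^∞`, then on a neighbourhood `U` of `x₀` there is a `C^∞` vector field `X` with
`mfderiv g x (X x) = c x` for `x ∈ U`. (As in `exists_local_lift_of_surjective_mfderiv`: in the chart at `x₀`,
`w(y) = S₀ (D(y) ∘ S₀)⁻¹ c(φ⁻¹ y)` with `S₀` a right inverse of `D(φ x₀)`.)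
[cite: BrockerJanichIDT1982, (8.12) (proof, local lifts)] -/
theorem exists_local_lift_eq_of_surjective_mfderiv
    (hg : ContMDiff I 𝓘(ℝ, F) ∞ g) {x₀ : N} (hsurj : Surjective (mfderiv I 𝓘(ℝ, F) g x₀))
    {c : N → F} (hc : ContMDiff I 𝓘(ℝ, F) ∞ c) :
    ∃ U ∈ 𝓝 x₀, ∃ X : Π x : N, TangentSpace I x,
      ContMDiffOn I I.tangent ∞ (fun x => (⟨x, X x⟩ : TangentBundle I N)) U ∧
      ∀ x ∈ U, mfderiv I 𝓘(ℝ, F) g x (X x) = c x := by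
  haveI : CompleteSpace EN := FiniteDimensional.complete ℝ EN
  haveI : CompleteSpace F := FiniteDimensional.complete ℝ F
  set φ := extChartAt I x₀ with hφ
  have hTo : IsOpen φ.target := isOpen_extChartAt_target x₀
  have hy₀ : φ x₀ ∈ φ.target := mem_extChartAt_target x₀
  -- `g` and `c` read in the chart
  set G : EN → F := g ∘ φ.symm with hG
  have hGs : ContDiffOn ℝ ∞ G φ.target :=
    contMDiffOn_iff_contDiffOn.1 (hg.comp_contMDiffOn (contMDiffOn_extChartAt_symm x₀))
  set C : EN → F := c ∘ φ.symm with hC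
  have hCs : ContDiffOn ℝ ∞ C φ.target :=
    contMDiffOn_iff_contDiffOn.1 (hc.comp_contMDiffOn (contMDiffOn_extChartAt_symm x₀))
  have hGd : ∀ y ∈ φ.target, HasFDerivAt G (fderiv ℝ G y) y := fun y hy =>
    ((hGs.differentiableOn (by simp)) y hy).differentiableAt (hTo.mem_nhds hy) |>.hasFDerivAt
  set D : EN → EN →L[ℝ] F := fderiv ℝ G with hD
  have hDs : ContDiffOn ℝ ∞ D φ.target := hGs.fderiv_of_isOpen hTo (by simp)
  -- the derivative at `φ x₀` is onto
  have hD₀ : Surjective (D (φ x₀)) := by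
    have h1 : HasMFDerivWithinAt 𝓘(ℝ, EN) I φ.symm (range I) (φ x₀)
        (mfderivWithin 𝓘(ℝ, EN) I φ.symm (range I) (φ x₀)) :=
      (mdifferentiableWithinAt_extChartAt_symm hy₀).hasMFDerivWithinAt
    have h2 : HasMFDerivAt I 𝓘(ℝ, F) g (φ.symm (φ x₀)) (mfderiv I 𝓘(ℝ, F) g (φ.symm (φ x₀))) :=
      (hg.mdifferentiableAt (by simp)).hasMFDerivAt
    have h3 := (h2.comp_hasMFDerivWithinAt (φ x₀) h1).hasMFDerivAt
      (by rw [ModelWithCorners.Boundaryless.range_eq_univ]; exact univ_mem)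
    rw [hasMFDerivAt_iff_hasFDerivAt] at h3
    have h4 : D (φ x₀) = (mfderiv I 𝓘(ℝ, F) g (φ.symm (φ x₀))).comp
        (mfderivWithin 𝓘(ℝ, EN) I φ.symm (range I) (φ x₀)) := h3.fderiv
    rw [h4]
    have h5 : φ.symm (φ x₀) = x₀ := extChartAt_to_inv x₀
    have hs1 : Surjective (mfderiv I 𝓘(ℝ, F) g (φ.symm (φ x₀))) := by rw [h5]; exact hsurj
    have hs2 : Surjective (mfderivWithin 𝓘(ℝ, EN) I φ.symm (range I) (φ x₀)) := by
      obtain ⟨e, he⟩ := isInvertible_mfderivWithin_extChartAt_symm (I := I) hy₀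
      rw [← he]; exact e.surjective
    exact hs1.comp hs2
  obtain ⟨S₀, hS₀⟩ :=
    ContinuousLinearMap.HasRightInverse.of_surjective_of_finiteDimensional hD₀
  set A : EN → F →L[ℝ] F := fun y => (D y).comp S₀ with hA
  have hAs : ContDiffOn ℝ ∞ A φ.target := hDs.clm_comp contDiffOn_const
  have hA₀ : A (φ x₀) = 1 := by
    ext v
    exact hS₀ v
  set O : Set EN := φ.target ∩ A ⁻¹' {f | IsUnit f} with hO
  have hOo : IsOpen O := hAs.continuousOn.isOpen_inter_preimage hTo Units.isOpen
  have hy₀O : φ x₀ ∈ O := ⟨hy₀, by rw [mem_preimage, mem_setOf_eq, hA₀]; exact isUnit_one⟩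
  have hAinv : ∀ y ∈ O, (A y).IsInvertible := fun y hy =>
    Literature.Analysis.ODE.isInvertible_of_isUnit hy.2
  -- the chart-level lift `w`, now with the varying target `C y`
  set w : EN → EN := fun y => S₀ ((A y).inverse (C y)) with hw
  have hws : ContDiffOn ℝ ∞ w O := by
    have h1 : ContDiffOn ℝ ∞ (fun y => (A y).inverse) O := fun y hy =>
      ((hAinv y hy).contDiffAt_map_inverse).comp_contDiffWithinAt y
        ((hAs y hy.1).mono inter_subset_left)
    exact S₀.contDiff.comp_contDiffOn (h1.clm_apply (hCs.mono inter_subset_left))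
  have hDw : ∀ y ∈ O, D y (w y) = C y := by
    intro y hy
    show ((D y).comp S₀) ((A y).inverse (C y)) = C y
    exact apply_inverse_of_isInvertible (hAinv y hy) (C y)
  set W : Π y : EN, TangentSpace 𝓘(ℝ, EN) y := w with hW
  set X : Π x : N, TangentSpace I x := VectorField.mpullback I 𝓘(ℝ, EN) φ W with hX
  set U : Set N := φ.source ∩ φ ⁻¹' O with hU
  have hUo : IsOpen U := isOpen_extChartAt_preimage' x₀ hOo
  have hx₀U : x₀ ∈ U := ⟨mem_extChartAt_source x₀, hy₀O⟩
  refine ⟨U, hUo.mem_nhds hx₀U, X, fun x hx => ?_, fun x hx => ?_⟩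
  · have hxc : x ∈ (chartAt H x₀).source := by rw [← extChartAt_source I]; exact hx.1
    have hV : ContMDiffAt 𝓘(ℝ, EN) 𝓘(ℝ, EN).tangent ∞
        (fun y => (⟨y, W y⟩ : TangentBundle 𝓘(ℝ, EN) EN)) (φ x) :=
      contMDiffAt_vectorSpace_iff_contDiffAt.2 (hws.contDiffAt (hOo.mem_nhds hx.2))
    exact (ContMDiffAt.mpullback_vectorField_preimage (n := ∞) hV (contMDiffAt_extChartAt' hxc)
      (isInvertible_mfderiv_extChartAt hx.1) (by simp)).contMDiffWithinAt
  · have hxc : x ∈ (chartAt H x₀).source := by rw [← extChartAt_source I]; exact hx.1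
    have hφx : φ x ∈ φ.target := φ.map_source hx.1
    have h1 : HasMFDerivAt I 𝓘(ℝ, EN) φ x (mfderiv I 𝓘(ℝ, EN) φ x) :=
      (mdifferentiableAt_extChartAt hxc).hasMFDerivAt
    have h2 : HasMFDerivAt 𝓘(ℝ, EN) 𝓘(ℝ, F) G (φ x) (D (φ x)) := (hGd (φ x) hφx).hasMFDerivAt
    have h3 : HasMFDerivAt I 𝓘(ℝ, F) (G ∘ φ) x ((D (φ x)).comp (mfderiv I 𝓘(ℝ, EN) φ x)) :=
      h2.comp x h1
    have heq : G ∘ φ =ᶠ[𝓝 x] g := by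
      filter_upwards [extChartAt_source_mem_nhds' hx.1] with z hz
      show g (φ.symm (φ z)) = g z
      rw [φ.left_inv hz]
    have h4 : mfderiv I 𝓘(ℝ, F) g x = (D (φ x)).comp (mfderiv I 𝓘(ℝ, EN) φ x) :=
      (h3.congr_of_eventuallyEq heq.symm).mfderiv
    rw [h4]
    show D (φ x) (mfderiv I 𝓘(ℝ, EN) φ x ((mfderiv I 𝓘(ℝ, EN) φ x).inverse (w (φ x)))) = c x
    rw [apply_inverse_of_isInvertible (isInvertible_mfderiv_extChartAt hx.1), hDw (φ x) hx.2]
    show c (φ.symm (φ x)) = c x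
    rw [φ.left_inv hx.1]

variable [T2Space N] [SigmaCompactSpace N]

-- the fibres of the tangent bundle are the model vector space by definition
set_option backward.isDefEq.respectTransparency false in
/-- **Global lift with prescribed smoothly varying values** (Bröcker–Jänich (8.12), proof: "glueing together the
locally chosen fields by means of a partition of unity"): for `g : N → F` `C^∞` with onto differential everywhere on a
`σ`-compact Hausdorff manifold and `c : N → F` `C^∞`, there is a `C^∞` field `X` with `mfderiv g x (X x) = c x` for all
`x`. [cite: BrockerJanichIDT1982, (8.12) (proof, lifting the basic fields)] -/
theorem exists_contMDiff_lift_eq_of_surjective_mfderiv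
    (hg : ContMDiff I 𝓘(ℝ, F) ∞ g) (hsurj : ∀ x, Surjective (mfderiv I 𝓘(ℝ, F) g x))
    {c : N → F} (hc : ContMDiff I 𝓘(ℝ, F) ∞ c) :
    ∃ X : Π x : N, TangentSpace I x,
      ContMDiff I I.tangent ∞ (fun x => (⟨x, X x⟩ : TangentBundle I N)) ∧
      ∀ x, mfderiv I 𝓘(ℝ, F) g x (X x) = c x := by
  set t : ∀ x : N, Set (TangentSpace I x) := fun x => {v | mfderiv I 𝓘(ℝ, F) g x v = c x} with ht
  have htc : ∀ x, Convex ℝ (t x) := fun x =>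
    (convex_singleton (c x)).linear_preimage (mfderiv I 𝓘(ℝ, F) g x).toLinearMap
  have hloc : ∀ x₀ : N, ∃ U ∈ 𝓝 x₀, ∃ X : Π x : N, TangentSpace I x,
      ContMDiffOn I (I.prod 𝓘(ℝ, EN)) ∞ (fun x => TotalSpace.mk' EN x (X x)) U ∧
      ∀ y ∈ U, X y ∈ t y := fun x₀ =>
    exists_local_lift_eq_of_surjective_mfderiv hg (hsurj x₀) hc
  obtain ⟨s, hs⟩ := exists_contMDiffSection_forall_mem_convex_of_local (n := (⊤ : ℕ∞)) I
    (fun x => TangentSpace I x) t htc hloc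
  exact ⟨s, s.contMDiff, hs⟩

/-- **Lift of a vector field of the base**: for `g : N → F` a `C^∞` submersion (onto differential everywhere) of a
`σ`-compact Hausdorff manifold and a `C^∞` vector field `W : F → F` on the base, there is a `C^∞` field `X` on `N`
with `mfderiv g x (X x) = W (g x)` — so that `g` maps integral curves of `X` to integral curves of `W` (AGZV II §1.1:
the monodromy flow covering the rotation of the base). [cite: BrockerJanichIDT1982, (8.12) (proof, lifting the basic fields)]
[cite: ArnoldGuseinzadeVarchenko2012, Part I §1.1 (held text p0013)] -/
theorem exists_contMDiff_lift_vectorField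
    (hg : ContMDiff I 𝓘(ℝ, F) ∞ g) (hsurj : ∀ x, Surjective (mfderiv I 𝓘(ℝ, F) g x))
    {W : F → F} (hW : ContDiff ℝ ∞ W) :
    ∃ X : Π x : N, TangentSpace I x,
      ContMDiff I I.tangent ∞ (fun x => (⟨x, X x⟩ : TangentBundle I N)) ∧
      ∀ x, mfderiv I 𝓘(ℝ, F) g x (X x) = W (g x) :=
  exists_contMDiff_lift_eq_of_surjective_mfderiv hg hsurj (hW.contMDiff.comp hg)

-- the fibres of the tangent bundle are the model vector space by definition
set_option backward.isDefEq.respectTransparency false in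
/-- **Lift of a vector field of the base, tangent to the level sets of an auxiliary function along a closed set.**
Let `g : N → F` be a `C^∞` submersion of a `σ`-compact Hausdorff manifold, `W : F → F` a `C^∞` vector field,
`ρ : N → F₂` `C^∞`, and `K ⊆ N` closed such that the pair `(g, ρ) : N → F × F₂` has onto differential at every point
of `K`. Then there is a `C^∞` field `X` with `mfderiv g x (X x) = W (g x)` for ALL `x` and `mfderiv ρ x (X x) = 0` for
`x ∈ K` (near `K` lift `(W ∘ g, 0)` through `(g, ρ)`, away from the closed `K` lift `W ∘ g` through `g`; the conditions
are affine in `X x` and glue by a partition of unity). This is how the monodromy vector field of a degeneration is made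
tangent to the spheres of a Milnor ball in a shell, so that its flow preserves the ball and its complement
(AGZV II §1.1, §2.1). [cite: BrockerJanichIDT1982, (8.12) (proof, lifting the basic fields)]
[cite: ArnoldGuseinzadeVarchenko2012, Part I §1.1 (held text p0013, p0025) and §2.1] -/
theorem exists_contMDiff_lift_vectorField_tangent
    (hg : ContMDiff I 𝓘(ℝ, F) ∞ g) (hsurj : ∀ x, Surjective (mfderiv I 𝓘(ℝ, F) g x))
    {W : F → F} (hW : ContDiff ℝ ∞ W)
    {F₂ : Type*} [NormedAddCommGroup F₂] [NormedSpace ℝ F₂] [FiniteDimensional ℝ F₂]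
    {ρ : N → F₂} (hρ : ContMDiff I 𝓘(ℝ, F₂) ∞ ρ) {K : Set N} (hK : IsClosed K)
    (hsurj₂ : ∀ x ∈ K, Surjective (mfderiv I 𝓘(ℝ, F × F₂) (fun y => (g y, ρ y)) x)) :
    ∃ X : Π x : N, TangentSpace I x,
      ContMDiff I I.tangent ∞ (fun x => (⟨x, X x⟩ : TangentBundle I N)) ∧
      (∀ x, mfderiv I 𝓘(ℝ, F) g x (X x) = W (g x)) ∧
      ∀ x ∈ K, mfderiv I 𝓘(ℝ, F₂) ρ x (X x) = 0 := by
  -- the pair map and its differential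
  set g₂ : N → F × F₂ := fun y => (g y, ρ y) with hg₂
  have hg₂s : ContMDiff I 𝓘(ℝ, F × F₂) ∞ g₂ := hg.prodMk_space hρ
  have hmf₂ : ∀ x (v : TangentSpace I x), mfderiv I 𝓘(ℝ, F × F₂) g₂ x v =
      (mfderiv I 𝓘(ℝ, F) g x v, mfderiv I 𝓘(ℝ, F₂) ρ x v) := by
    intro x v
    have h1 : HasMFDerivAt I 𝓘(ℝ, F) g x (mfderiv I 𝓘(ℝ, F) g x) := (hg.mdifferentiableAt (by simp)).hasMFDerivAt
    have h2 : HasMFDerivAt I 𝓘(ℝ, F₂) ρ x (mfderiv I 𝓘(ℝ, F₂) ρ x) := (hρ.mdifferentiableAt (by simp)).hasMFDerivAt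
    have h3 : HasMFDerivAt I 𝓘(ℝ, F × F₂) g₂ x ((mfderiv I 𝓘(ℝ, F) g x).prod (mfderiv I 𝓘(ℝ, F₂) ρ x)) := by
      rw [modelWithCornersSelf_prod]
      exact h1.prodMk h2
    rw [h3.mfderiv]
    rfl
  -- the target values: `(W (g x), 0)`
  set c₂ : N → F × F₂ := fun y => (W (g y), 0) with hc₂
  have hc₂s : ContMDiff I 𝓘(ℝ, F × F₂) ∞ c₂ := (hW.contMDiff.comp hg).prodMk_space contMDiff_const
  -- the convex condition sets
  set t : ∀ x : N, Set (TangentSpace I x) := fun x =>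
    {v | mfderiv I 𝓘(ℝ, F) g x v = W (g x) ∧ (x ∈ K → mfderiv I 𝓘(ℝ, F₂) ρ x v = 0)} with ht
  have htc : ∀ x, Convex ℝ (t x) := by
    intro x
    by_cases hx : x ∈ K
    · have : t x = {v | mfderiv I 𝓘(ℝ, F × F₂) g₂ x v = (W (g x), 0)} := by
        ext v
        simp only [ht, mem_setOf_eq, hmf₂, hx, forall_const]
        exact ⟨fun h => Prod.ext h.1 h.2, fun h => ⟨congrArg Prod.fst h, congrArg Prod.snd h⟩⟩
      rw [this]
      exact (convex_singleton _).linear_preimage (mfderiv I 𝓘(ℝ, F × F₂) g₂ x).toLinearMap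
    · have : t x = {v | mfderiv I 𝓘(ℝ, F) g x v = W (g x)} := by
        ext v
        simp only [ht, mem_setOf_eq, hx, IsEmpty.forall_iff, and_true]
      rw [this]
      exact (convex_singleton _).linear_preimage (mfderiv I 𝓘(ℝ, F) g x).toLinearMap
  -- local lifts
  have hloc : ∀ x₀ : N, ∃ U ∈ 𝓝 x₀, ∃ X : Π x : N, TangentSpace I x,
      ContMDiffOn I (I.prod 𝓘(ℝ, EN)) ∞ (fun x => TotalSpace.mk' EN x (X x)) U ∧
      ∀ y ∈ U, X y ∈ t y := by
    intro x₀
    by_cases hx₀ : x₀ ∈ K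
    · -- near `K`: lift `(W ∘ g, 0)` through the pair map
      obtain ⟨U, hU, X, hXs, hX⟩ := exists_local_lift_eq_of_surjective_mfderiv hg₂s (hsurj₂ x₀ hx₀) hc₂s
      refine ⟨U, hU, X, hXs, fun y hy => ?_⟩
      have h := hX y hy
      rw [hmf₂, hc₂] at h
      exact ⟨congrArg Prod.fst h, fun _ => congrArg Prod.snd h⟩
    · -- away from `K`: lift `W ∘ g` through `g` on a neighbourhood missing `K`
      obtain ⟨U, hU, X, hXs, hX⟩ := exists_local_lift_eq_of_surjective_mfderiv hg (hsurj x₀) (hW.contMDiff.comp hg)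
      refine ⟨U ∩ Kᶜ, inter_mem hU (hK.isOpen_compl.mem_nhds hx₀), X, hXs.mono inter_subset_left, fun y hy => ?_⟩
      exact ⟨hX y hy.1, fun hyK => absurd hyK hy.2⟩
  obtain ⟨s, hs⟩ := exists_contMDiffSection_forall_mem_convex_of_local (n := (⊤ : ℕ∞)) I
    (fun x => TangentSpace I x) t htc hloc
  exact ⟨s, s.contMDiff, fun x => (hs x).1, fun x hx => (hs x).2 hx⟩

end Lift

end Literature.Geometry.Manifold

end
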